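import Literature.MathematicalPhysics.QuantumFieldTheory.BalabanImbrieJaffe1984to88.BIJ88Regularity286EndToEnd
import Literature.MathematicalPhysics.QuantumFieldTheory.BalabanImbrieJaffe1984to88.BIJ88Eq534Locality

/-!
# `BalabanImbrieJaffe1984to88.BIJ88RegularityJ286EndToEnd` — T. Bałaban, J. Imbrie, A. Jaffe, *Effective action and cluster properties of the
abelian Higgs model*, Commun. Math. Phys. **114** (1988) 257–315 [BalabanImbrieJaffe1988], Sect. 5.6 p. 286 [PDF 30], the last sentence of the
regularity paragraph, verbatim: *"In an analogous fashion we can check that the j-th regularity condition for r(e_k)-cubes remains valid."* —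
COMPOSED END TO END ON THE TORUS CARRIER OF RECORD (kind «model instance»; the «e_j ζ version» clause of the owner's flip condition for row
C2.Claim@286, ROWS-C2-part2 v2.46).

statement-level skeleton of published theorems with citation tags; proofs where landed; nothing here is a claim about the Yang–Mills mass gap

WHAT IS PROVED (0 `sorry`, 0 `def`, standard axioms): **`regular286J_uTilde561_endToEnd`** — in the setting of gen 8's
`BIJ88Eq5514Torus.eq5514_torus` (the data `u′, v, Λ = X, A = A^{(k)}, V, L`, the operators `T_k, 𝒟_{k,loc}, 𝒟^η_{k+1,loc}, ∂*Q^{e*}_k = S, H_k,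
H_{k,loc}, C_k, C^{(k)}_{loc}, H*_{k,loc}, Q^{e*}, f`, the regions `Λ̄₂ = Xb ⊇ X₀`, `Λ̄₃ = S₃`, `w₁` as the operator `W1` defined by (5.4.3)–(5.4.4)),
for the translated unit-lattice field (5.3.1) `u = u′·cutoff_Λ(Q^{s*}v)` and its background field (4.2) `u_k = backgroundU e_k η (Q^{s*}_ku)
(𝒟_{k,loc}∂*Q^{e*}_kf^{(k)})`, `f^{(k)}(p) = arg u(p)/e_k`: the `j`-th regularity condition (4.3) p. 274 (units `e_j`, `ζ = L^{−j}`; r16's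
`Regular286 cube Gs e_j ζ c p(e_j) r(e_j)`) **of `u_k` — the INDUCTION HYPOTHESIS (4.3) of the inductive description of the k-th density, a
printed input on its own row —** together with (5.3.2) on `Λ̄₂^{(k)**}`, the range statements (`hdep`, `hΛ₄`), `h541`, `h5511`, `hW1`, the bounds
`|A^{(k)}| ≦ c_Ap(e_k)` (5.9.4), `|A′| ≦ c_{A′}p(e_k)` (p. 280), the row sums `K₀, K₁, K₂` of `H_{k,loc}` and `W₀, W₁, W₂` of `w₁` (matrix elements, with
their `∂^η`, `∂^{η*}`), `|θ_k| ≦ 1` with Lipschitz constant `ℓ`, and the three DISPLAYED side conditions in the units of the `j`-th condition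
(`ρ = e_kη/(e_jζ)`, `∂^ζ = (η/ζ)∂^η`: `|ρ|(K₀c_Ap + W₀c_{A′}p) ≦ c′p(e_j)r(e_j)`, `|ρ(η/ζ)|(K₁c_Ap + 2|η⁻¹|ℓK₀c_Ap + W₁c_{A′}p) ≦ c′p(e_j)r(e_j)`,
`|ρ(η/ζ)|(K₂c_Ap + d|η⁻¹|ℓK₀c_Ap + W₂c_{A′}p) ≦ c′p(e_j)r(e_j)`) IMPLY `Regular286 cube Gs e_j ζ (c + c′) p(e_j) r(e_j) (uTilde561 e_k η L
(Q^{s*}_{k+1}v) θ_k (H_{k,loc}A^{(k)}) (𝒟^η_{k+1,loc}∂*Q^{e*}_{k+1}f))`.  Chain: gen 8 `eq5514_torus` at each cube bond (the (5.5.14) field `u′_k` is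
a gauge transform of `u_k`) → r16's `regular286_of_eqOn_gaugeU` (*"The gauge transformation does not change the regularity"*, any units) → file 5's
`linearMap_fieldBounds` (the kernel bounds in the `→ₗ[ℝ]` currency) → gen 9's `BIJ88RegularityJ286.regular286J_uTilde561_of_fieldBounds` (removal of
`θ_kH_{k,loc}A^{(k)} + w₁A′` read in the units `(e_j, ζ)`).
ALSO (§2): **`regular286_uTilde561_endToEnd_actual`** — file 5's hypothesis-free k-th condition theorem with its displayed (5.3.2)
hypothesis `h532` DISCHARGED by gen 8's `BIJ88Eq534Locality.fieldStrength_transl_of_mem_starP` ((5.3.2) on `B¹(Λ)**` for the translated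
field, the cut-off invisible there) in the concrete reading `Q^{e*} = qstarLin` (p30), `f = argB(v(p′))/e_k`, `L = P.L`: what replaces `h532` is
the region inclusion `Λ̄₂^{(k)**} ⊆ B¹(Λ)**` (`hXb1`) and the principal-branch smallness `|e_k(∂A′ + L^{−2}Q^{e*}f)| < π` on `Λ̄₂^{(k)**}` (p. 280
«|A′|, |f| ≦ cp(e_k)», gen 8's `small_of_bounds`).
HONEST SCOPE.  For `j < k` the input IS a regularity statement — the induction hypothesis (4.3)_j for `u_k`, which the print uses here («remains
valid»); this is the intended logical structure, not a gap (for `j = k` the hypothesis-free theorem is file 5's `regular286_uTilde561_endToEnd`).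
The printed size relations `ρ = L^{(k−j)(2−d)/2} ≦ 1`, `η/ζ = L^{−(k−j)} ≦ 1`, `p(e_k)r(e_k) ≦ p(e_j)r(e_j)` ((2.2)–(2.3)) that make the side
conditions hold with `c′` independent of `j, k` are NOT derived (displayed hypotheses `h₀ h₁ h₂`, as in gen 9).  Imports: file 5
`BIJ88Regularity286EndToEnd` (p306031).  Unit `lit-balaban-p31` (literature-prover-lit-balaban-p31-g9-0), 2026-08-21.  NOT summit progress.
-/

namespace Literature.MathematicalPhysics.QuantumFieldTheory.BalabanImbrieJaffe1984to88.BIJ88RegularityJ286EndToEnd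

open Literature.MathematicalPhysics.QuantumFieldTheory.Balaban1983to89
open BIJ88Sect3Statements (U1 toC cfg plaqVar plaqVar_cfg starB mem_starB starP gaugeU fieldStrength)
open BIJ88Sect4Statements (backgroundU bgGaugeU bgGaugeU_eq)
open BIJ88Regularity286 (Regular286 cubeSites regular286_of_eqOn_gaugeU)
open BIJ88Sect5StatementsPart3 (bgExp uTilde561)
open BIJ88Eq564Torus (starB_mono)
open BIJ88Eq5514Torus (eq5514_torus)
open BIJ88RegularityJ286 (regular286J_uTilde561_of_fieldBounds)
open BIJ88Regularity286EndToEnd (linearMap_fieldBounds regular286_uTilde561_endToEnd)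
open BIJ88Eq534Locality (fieldStrength_transl_of_mem_starP)
open BIJ88Smooth43Axial (norm_plaqVar_cfg fieldStrength_of_norm_one)
open BIJ85Sect1Model (argB)
open BIJ85Eq611Torus (qstarLin)
open T4AxialGaugeSmallField (boxBonds boxPlaqs castSite)
open BIJ85BlockAveragesTorus (expU1 surfMul)
open BIJ85Eq453GaugeField (qsstarGIter)
open BIJ85Eq224Proof (torusBlockBondsIter)
open BIJ88Eq536Linearization (cutoff)
open BIJ88Eq533Torus (blockUnion)
open LatticeFieldCalculus (grad curl diverg supDist)
open Complex
open scoped Real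

noncomputable section

variable {P : Params} {i : ℕ}

/-! ## §1  The `j`-th condition end to end (input: the induction hypothesis (4.3)_j for `u_k`) -/

/-- **«In an analogous fashion we can check that the j-th regularity condition for r(e_k)-cubes remains valid» — END TO END ON THE TORUS.**
SETTING = gen 8's `eq5514_torus` + `w₁` as the operator `W1` (`hW1`, (5.4.3)–(5.4.4) with `□ = Λ̄₂^{(k)*}`); the translated field (5.3.1) `u =
u′·cutoff_Λ(Q^{s*}v)` (`h531`), its background field `u_k = backgroundU e_k η (Q^{s*}_ku) (𝒟_{k,loc}∂*Q^{e*}_kf^{(k)})`, `f^{(k)} = arg u(p)/e_k`.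
INPUT OF RECORD: the INDUCTION HYPOTHESIS (4.3)_j for `u_k` (`hUj : Regular286 cube Gs e_j ζ c p(e_j) r(e_j) u_k`, `j < k`, units `e_j`, `ζ = L^{−j}`).
FURTHER HYPOTHESES (printed data): `hu'` (`u′ = e^{ie_kA′}` on `B¹(Λ)*`, `A′ = A − L^{−2}V`), (5.3.2) on `Λ̄₂^{(k)**}` (`h532`), the range statements
`hdep` (at a cube bond `𝒟_{k,loc}∂*Q^{e*}_kF` sees `F` on `Λ̄₂^{(k)**}` only) and `hΛ₄`, `h541`, `h5511`, the cubes inside `B^{k+1}(Λ) ∩ B^k(X₀) ∩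
Λ̄₃` (`hc₁ hc₀ hc₃`), `|A| ≦ c_Ap`, `|A′| ≦ c_{A′}p`, row sums `K₀ K₁ K₂` (`H_{k,loc}`), `W₀ W₁ W₂` (`w₁`), `|θ_k| ≦ 1` Lipschitz `ℓ`, and the
three displayed side conditions in the `j`-th units (`ρ = e_kη/(e_jζ)`).  CONCLUSION: **`Regular286 cube Gs e_j ζ (c + c′) p(e_j) r(e_j)
(uTilde561 e_k η L (Q^{s*}_{k+1}v) θ_k (H_{k,loc}A^{(k)}) (𝒟^η_{k+1,loc}∂*Q^{e*}_{k+1}f))`**. [cite: BalabanImbrieJaffe1988, (4.3) p.286] -/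
theorem regular286J_uTilde561_endToEnd {k : ℕ} (hk : i + k + 1 ≤ P.m + P.K) {ek η ej ζ : ℝ} (hej : ej ≠ 0) (hζ : ζ ≠ 0)
    (hη : η * (P.L : ℝ) ^ k = 1)
    -- the fields of (5.3.1) and the translated unit-lattice field `u`
    (X : Finset (Balaban1983to89.Site P (i + k + 1))) {u' : GaugeField P (i + k) U1} (A V : PBond P (i + k) → ℝ) (L : ℝ)
    (hu' : ∀ c ∈ starB (blockUnion 1 X), u' c = expU1 (ek * (A - L⁻¹ ^ 2 • V) c)) (v : GaugeField P (i + k + 1) U1)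
    {u : GaugeField P (i + k) U1} (h531 : u = surfMul u' (cutoff (starB X) v))
    -- the operators of `eq5514_torus` and `w₁`
    {Plc : Type*} (Tk : (Balaban1983to89.Plaq P (i + k) → ℝ) →ₗ[ℝ] (PBond P i → ℝ))
    (Dloc Dnext : (PBond P i → ℝ) →ₗ[ℝ] (PBond P i → ℝ)) (S : (Balaban1983to89.Plaq P (i + k) → ℝ) →ₗ[ℝ] (PBond P i → ℝ))
    (Hk Hloc : (PBond P (i + k) → ℝ) →ₗ[ℝ] (PBond P i → ℝ)) (Ck : (PBond P (i + k) → ℝ) →ₗ[ℝ] (Balaban1983to89.Site P i → ℝ))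
    (Cloc : (PBond P (i + k) → ℝ) →ₗ[ℝ] (PBond P (i + k) → ℝ)) (Hsloc : (PBond P i → ℝ) →ₗ[ℝ] (PBond P (i + k) → ℝ))
    (h541 : ∀ (B : PBond P (i + k) → ℝ) (b : PBond P i),
      (torusBlockBondsIter P i k).Qsstar B b - Tk (curl 1 B) b = Hk B b + grad η⁻¹ (Ck B) b)
    (h5511 : Dloc + Hloc ∘ₗ Cloc ∘ₗ Hsloc = Dnext)
    (Qes : (Plc → ℝ) →ₗ[ℝ] (Balaban1983to89.Plaq P (i + k) → ℝ)) (f : Plc → ℝ)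
    (Xb X₀ : Finset (Balaban1983to89.Site P (i + k))) (hX₀ : X₀ ⊆ Xb) (S₃ : Finset (Balaban1983to89.Site P i))
    (W1 : (PBond P (i + k) → ℝ) →ₗ[ℝ] (PBond P i → ℝ))
    (hW1 : ∀ (B : PBond P (i + k) → ℝ) (b : PBond P i),
      W1 B b = Tk (curl 1 ((↑(starB Xb) : Set (PBond P (i + k))).indicator B)) b -
          Dloc (S (curl 1 ((↑(starB Xb) : Set (PBond P (i + k))).indicator B))) b +
        (Hk ((↑(starB Xb) : Set (PBond P (i + k))).indicator B) b - Hloc B b))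
    -- the cubes and their standing ranges
    {γ : Type*} (cube : Balaban1983to89.Site P i → γ) (Gs : Set γ)
    {c c' pej rej pek ℓ cA cA' K₀ K₁ K₂ W₀ W₁ W₂ : ℝ} (hp : 0 ≤ pek) (hcA : 0 ≤ cA) (hcA' : 0 ≤ cA')
    (hc₁ : ∀ l ∈ Gs, cubeSites cube l ⊆ blockUnion (k + 1) X) (hc₀ : ∀ l ∈ Gs, cubeSites cube l ⊆ blockUnion k X₀)
    (hc₃ : ∀ l ∈ Gs, cubeSites cube l ⊆ S₃)
    -- (5.3.2) on `Λ̄₂^{(k)**}`; the range statements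
    (h532 : ∀ p ∈ starP Xb, arg (plaqVar (cfg u) p) / ek = curl 1 (A - L⁻¹ ^ 2 • V) p + L⁻¹ ^ 2 * Qes f p)
    (hdep : ∀ l ∈ Gs, ∀ b ∈ starB (cubeSites cube l), ∀ F₁ F₂ : Balaban1983to89.Plaq P (i + k) → ℝ,
      (∀ p ∈ starP Xb, F₁ p = F₂ p) → Dloc (S F₁) b = Dloc (S F₂) b)
    (hΛ₄ : ∀ l ∈ Gs, ∀ b ∈ starB (cubeSites cube l), Hloc V b = Hloc (Cloc (Hsloc (S (Qes f)))) b)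
    -- THE INDUCTION HYPOTHESIS (4.3)_j for `u_k`
    (hUj : Regular286 cube Gs ej ζ c pej rej
      (backgroundU ek η (fun b => toC (qsstarGIter k u b)) (Dloc (S fun p => arg (plaqVar (cfg u) p) / ek))))
    -- the printed bounds: (5.9.4), p. 280, the kernel row sums of `H_{k,loc}` and `w₁`, `θ_k`
    (hA : ∀ b', |A b'| ≤ cA * pek) (hA' : ∀ b', |(A - L⁻¹ ^ 2 • V) b'| ≤ cA' * pek)
    (hK₀ : ∀ b, ∑ b', |Hloc (fun j => if b' = j then (1 : ℝ) else 0) b| ≤ K₀)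
    (hK₁ : ∀ p, ∑ b', |curl η⁻¹ (fun b => Hloc (fun j => if b' = j then (1 : ℝ) else 0) b) p| ≤ K₁)
    (hK₂ : ∀ x, ∑ b', |diverg η⁻¹ (fun b => Hloc (fun j => if b' = j then (1 : ℝ) else 0) b) x| ≤ K₂)
    (hW₀ : ∀ b, ∑ b', |W1 (fun j => if b' = j then (1 : ℝ) else 0) b| ≤ W₀)
    (hW₁ : ∀ p, ∑ b', |curl η⁻¹ (fun b => W1 (fun j => if b' = j then (1 : ℝ) else 0) b) p| ≤ W₁)
    (hW₂ : ∀ x, ∑ b', |diverg η⁻¹ (fun b => W1 (fun j => if b' = j then (1 : ℝ) else 0) b) x| ≤ W₂)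
    {θ : PBond P i → ℝ} (hθ : ∀ b, |θ b| ≤ 1)
    (hLip : ∀ b b' : PBond P i, |θ b - θ b'| ≤ ℓ * (supDist b.src b'.src : ℝ)) (hℓ : 0 ≤ ℓ)
    -- the three displayed side conditions in the units of the `j`-th condition
    (h₀ : |ek * η / (ej * ζ)| * (K₀ * (cA * pek) + W₀ * (cA' * pek)) ≤ c' * pej * rej)
    (h₁ : |ek * η / (ej * ζ) * (η / ζ)| * (K₁ * (cA * pek) + 2 * |η⁻¹| * ℓ * (K₀ * (cA * pek)) + W₁ * (cA' * pek)) ≤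
      c' * pej * rej)
    (h₂ : |ek * η / (ej * ζ) * (η / ζ)| * (K₂ * (cA * pek) + P.d * |η⁻¹| * ℓ * (K₀ * (cA * pek)) + W₂ * (cA' * pek)) ≤
      c' * pej * rej) :
    Regular286 cube Gs ej ζ (c + c') pej rej
      (uTilde561 ek η L (fun b => toC (qsstarGIter (k + 1) v b)) θ (Hloc A) (Dnext (S (Qes f)))) := by
  have hη0 : η ≠ 0 := by
    rintro rfl
    rw [zero_mul] at hη
    exact zero_ne_one hη
  -- on the cube bonds the (5.5.14) field `u′_k` is a gauge transform of `u_k` (`eq5514_torus`): the `j`-th condition passes to it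
  have hU' : Regular286 cube Gs ej ζ c pej rej
      (bgExp ek η (fun b => toC (qsstarGIter (k + 1) v b))
        fun b => Hloc A b - L⁻¹ ^ 2 * Dnext (S (Qes f)) b + W1 (A - L⁻¹ ^ 2 • V) b) := by
    refine regular286_of_eqOn_gaugeU
      (fun x => ek * (↑S₃ : Set (Balaban1983to89.Site P i)).indicator
        (Ck ((↑(starB Xb) : Set (PBond P (i + k))).indicator (A - L⁻¹ ^ 2 • V))) x)
      (fun l hl b hb => ?_) hUj
    have hT : Dloc (S fun p => arg (plaqVar (cfg u) p) / ek) b = Dloc (S (curl 1 (A - L⁻¹ ^ 2 • V) + L⁻¹ ^ 2 • Qes f)) b :=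
      hdep l hl b hb _ _ fun p hpl => by
        simp only [Pi.add_apply, Pi.smul_apply, smul_eq_mul]
        exact h532 p hpl
    have e := eq5514_torus hk hη X A V L hu' v (Dloc (S fun p => arg (plaqVar (cfg u) p) / ek)) Tk Dloc Dnext S Hk Hloc Ck Cloc
      Hsloc h541 h5511 Qes f Xb X₀ hX₀ S₃ (starB_mono (hc₁ l hl) hb) (starB_mono (hc₀ l hl) hb) (starB_mono (hc₃ l hl) hb) hT
      (hdep l hl b hb) (hΛ₄ l hl b hb)
    rw [bgGaugeU_eq hη0, ← h531] at e
    simp only [bgExp] at e ⊢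
    rw [hW1]
    exact e.symm
  -- the kernel bounds on `H_{k,loc}A^{(k)}` and `w₁A′`, then gen 9's removal in the `j`-th units
  obtain ⟨a0, a1, a2⟩ := linearMap_fieldBounds (c := η⁻¹) Hloc (mul_nonneg hcA hp) hA hK₀ hK₁ hK₂
  obtain ⟨b0, b1, b2⟩ := linearMap_fieldBounds (c := η⁻¹) W1 (mul_nonneg hcA' hp) hA' hW₀ hW₁ hW₂
  exact regular286J_uTilde561_of_fieldBounds hej hζ hη0 L hU' hθ hLip hℓ a0 a1 a2 b0 b1 b2 h₀ h₁ h₂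

/-! ## §2  The k-th condition with (5.3.2) discharged (gen 8's `fieldStrength_transl_of_mem_starP`) -/

/-- **File 5's `regular286_uTilde561_endToEnd` WITH (5.3.2) AS A THEOREM INPUT**: in the concrete reading `Q^{e*} = qstarLin P hd (i + k)` (p30),
`f = (p′ ↦ argB(v(p′))/e_k)` (the real field strength of `v`), `L = P.L`, the displayed hypothesis `h532` of file 5 follows from gen 8's
`fieldStrength_transl_of_mem_starP` ((5.3.2) for the translated field (5.3.1) on `B¹(Λ)**`), given `Λ̄₂^{(k)**} ⊆ B¹(Λ)**` (`hXb1`) and the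
principal-branch smallness `hsm` on `Λ̄₂^{(k)**}`.  All other hypotheses and the conclusion as in file 5 (no regularity hypothesis).
[cite: BalabanImbrieJaffe1988, (4.3) p.286] -/
theorem regular286_uTilde561_endToEnd_actual {k : ℕ} (hk : i + k + 1 ≤ P.m + P.K) (hd : 2 ≤ P.d) {ek η : ℝ} (hek : 0 < ek)
    (hη : η * (P.L : ℝ) ^ k = 1)
    (X : Finset (Balaban1983to89.Site P (i + k + 1))) {u' : GaugeField P (i + k) U1} (A V : PBond P (i + k) → ℝ)
    (hu' : ∀ c ∈ starB (blockUnion 1 X), u' c = expU1 (ek * (A - (P.L : ℝ)⁻¹ ^ 2 • V) c)) (v : GaugeField P (i + k + 1) U1)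
    {u : GaugeField P (i + k) U1} (h531 : u = surfMul u' (cutoff (starB X) v))
    (Tk : (Balaban1983to89.Plaq P (i + k) → ℝ) →ₗ[ℝ] (PBond P i → ℝ))
    (Dloc Dnext : (PBond P i → ℝ) →ₗ[ℝ] (PBond P i → ℝ)) (S : (Balaban1983to89.Plaq P (i + k) → ℝ) →ₗ[ℝ] (PBond P i → ℝ))
    (Hk Hloc : (PBond P (i + k) → ℝ) →ₗ[ℝ] (PBond P i → ℝ)) (Ck : (PBond P (i + k) → ℝ) →ₗ[ℝ] (Balaban1983to89.Site P i → ℝ))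
    (Cloc : (PBond P (i + k) → ℝ) →ₗ[ℝ] (PBond P (i + k) → ℝ)) (Hsloc : (PBond P i → ℝ) →ₗ[ℝ] (PBond P (i + k) → ℝ))
    (h541 : ∀ (B : PBond P (i + k) → ℝ) (b : PBond P i),
      (torusBlockBondsIter P i k).Qsstar B b - Tk (curl 1 B) b = Hk B b + grad η⁻¹ (Ck B) b)
    (h5511 : Dloc + Hloc ∘ₗ Cloc ∘ₗ Hsloc = Dnext)
    (Xb X₀ : Finset (Balaban1983to89.Site P (i + k))) (hX₀ : X₀ ⊆ Xb) (S₃ : Finset (Balaban1983to89.Site P i))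
    (W1 : (PBond P (i + k) → ℝ) →ₗ[ℝ] (PBond P i → ℝ))
    (hW1 : ∀ (B : PBond P (i + k) → ℝ) (b : PBond P i),
      W1 B b = Tk (curl 1 ((↑(starB Xb) : Set (PBond P (i + k))).indicator B)) b -
          Dloc (S (curl 1 ((↑(starB Xb) : Set (PBond P (i + k))).indicator B))) b +
        (Hk ((↑(starB Xb) : Set (PBond P (i + k))).indicator B) b - Hloc B b))
    {γ : Type*} (cube : Balaban1983to89.Site P i → γ) (Gs : Set γ) (lo hi : γ → Fin P.d → ℤ)
    (X' : γ → Finset (Balaban1983to89.Site P (i + k))) {nb N : ℕ}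
    {cf pek rek ℓ cA cA' K₀ K₁ K₂ W₀ W₁ W₂ : ℝ} (hcf : 0 ≤ cf) (hp : 0 ≤ pek) (hr : 1 ≤ rek) (hcA : 0 ≤ cA) (hcA' : 0 ≤ cA')
    (hn : ∀ l ∈ Gs, ∀ κ, hi l κ ≤ lo l κ + nb) (hnN : nb < P.sitesPerDir (i + k)) (hnr : (nb : ℝ) ≤ N * rek)
    (hin : ∀ l ∈ Gs, ∀ x ∈ X' l,
      ∃ z : Fin P.d → ℤ, lo l ≤ z ∧ (∀ κ, z κ + 1 ≤ hi l κ) ∧ (castSite z : Balaban1983to89.Site P (i + k)) = x)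
    (hG : ∀ l ∈ Gs, cubeSites cube l ⊆ blockUnion k (X' l))
    (hboxB : ∀ l ∈ Gs, ∀ c ∈ boxBonds (lo l) (hi l), c ∈ starB Xb)
    (hboxP : ∀ l ∈ Gs, ∀ p ∈ boxPlaqs (lo l) (hi l), p ∈ starP Xb)
    (hc₁ : ∀ l ∈ Gs, cubeSites cube l ⊆ blockUnion (k + 1) X) (hc₀ : ∀ l ∈ Gs, cubeSites cube l ⊆ blockUnion k X₀)
    (hc₃ : ∀ l ∈ Gs, cubeSites cube l ⊆ S₃)
    (hf : ∀ l ∈ Gs, ∀ p ∈ boxPlaqs (lo l) (hi l), |arg (plaqVar (cfg u) p)| ≤ ek * (cf * pek))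
    (hsmall : (2 * π * ((P.d - 1 : ℕ) : ℝ) * nb + 1) * (ek * (cf * pek)) < 2 * π)
    -- in place of (5.3.2): the region inclusion and the principal-branch smallness of gen 8
    (hXb1 : starP Xb ⊆ starP (blockUnion 1 X))
    (hsm : ∀ p ∈ starP Xb, |ek * (curl 1 (A - (P.L : ℝ)⁻¹ ^ 2 • V) p +
      (P.L : ℝ)⁻¹ ^ 2 * qstarLin P hd (i + k) (fun q => argB (toC (GaugeField.plaqHol v q)) / ek) p)| < π)
    (hdep : ∀ l ∈ Gs, ∀ b ∈ starB (cubeSites cube l), ∀ F₁ F₂ : Balaban1983to89.Plaq P (i + k) → ℝ,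
      (∀ p ∈ boxPlaqs (lo l) (hi l), F₁ p = F₂ p) → Dloc (S F₁) b = Dloc (S F₂) b)
    (hΛ₄ : ∀ l ∈ Gs, ∀ b ∈ starB (cubeSites cube l),
      Hloc V b = Hloc (Cloc (Hsloc (S (qstarLin P hd (i + k) (fun q => argB (toC (GaugeField.plaqHol v q)) / ek))))) b)
    (hA : ∀ b', |A b'| ≤ cA * pek) (hA' : ∀ b', |(A - (P.L : ℝ)⁻¹ ^ 2 • V) b'| ≤ cA' * pek)
    (hK₀ : ∀ b, ∑ b', |Hloc (fun j => if b' = j then (1 : ℝ) else 0) b| ≤ K₀)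
    (hK₁ : ∀ p, ∑ b', |curl η⁻¹ (fun b => Hloc (fun j => if b' = j then (1 : ℝ) else 0) b) p| ≤ K₁)
    (hK₂ : ∀ x, ∑ b', |diverg η⁻¹ (fun b => Hloc (fun j => if b' = j then (1 : ℝ) else 0) b) x| ≤ K₂)
    (hW₀ : ∀ b, ∑ b', |W1 (fun j => if b' = j then (1 : ℝ) else 0) b| ≤ W₀)
    (hW₁ : ∀ p, ∑ b', |curl η⁻¹ (fun b => W1 (fun j => if b' = j then (1 : ℝ) else 0) b) p| ≤ W₁)
    (hW₂ : ∀ x, ∑ b', |diverg η⁻¹ (fun b => W1 (fun j => if b' = j then (1 : ℝ) else 0) b) x| ≤ W₂)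
    (hK₁' : 0 ≤ K₁) (hW₁' : 0 ≤ W₁)
    {θ : PBond P i → ℝ} (hθ : ∀ b, |θ b| ≤ 1)
    (hLip : ∀ b b' : PBond P i, |θ b - θ b'| ≤ ℓ * (supDist b.src b'.src : ℝ)) (hℓ : 0 ≤ ℓ) :
    Regular286 cube Gs ek η
      ((K₀ + W₀ + K₁ + W₁ + K₂ + W₂) * (π / 2 * ((P.d - 1 : ℕ) : ℝ) * N * cf) +
        ((K₀ * (1 + (2 + P.d) * |η⁻¹| * ℓ) + K₁ + K₂) * cA + (W₀ + W₁ + W₂) * cA')) pek rek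
      (uTilde561 ek η (P.L : ℝ) (fun b => toC (qsstarGIter (k + 1) v b)) θ (Hloc A)
        (Dnext (S (qstarLin P hd (i + k) (fun q => argB (toC (GaugeField.plaqHol v q)) / ek))))) := by
  refine regular286_uTilde561_endToEnd hk hek hη X A V (P.L : ℝ) hu' v h531 Tk Dloc Dnext S Hk Hloc Ck Cloc Hsloc h541 h5511
    (qstarLin P hd (i + k)) (fun q => argB (toC (GaugeField.plaqHol v q)) / ek) Xb X₀ hX₀ S₃ W1 hW1 cube Gs lo hi X' hcf hp hr
    hcA hcA' hn hnN hnr hin hG hboxB hboxP hc₁ hc₀ hc₃ hf hsmall (fun p hpl => ?_) hdep hΛ₄ hA hA' hK₀ hK₁ hK₂ hW₀ hW₁ hW₂ hK₁'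
    hW₁' hθ hLip hℓ
  -- (5.3.2) at `p ∈ Λ̄₂** ⊆ B¹(Λ)**`, read through `f = arg u(p)/e_k` on the unit circle
  have h := fieldStrength_transl_of_mem_starP hk hd hek.ne' X hu' v (hXb1 hpl) (hsm p hpl)
  rw [← h531, ← plaqVar_cfg, fieldStrength_of_norm_one ek (norm_plaqVar_cfg u p)] at h
  exact_mod_cast h

end

end Literature.MathematicalPhysics.QuantumFieldTheory.BalabanImbrieJaffe1984to88.BIJ88RegularityJ286EndToEnd
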